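import Summits.CriticalPhenomena.CardyFormulaZ2.Theorems.CardyUSTContinuationKirchhoffExtremalLengthG02Dual7

/-!
# A local bound for the conjugate near boundary points, II: the maximum principle step
# ([GP19] §3.2 local form, for the `meshDomain` / `discreteArc` discretisation)

Support file for `KirchhoffExtremalLength` (route CardyUSTContinuation of `CardyFormulaZ2`, item
stmt-CriticalPhenomena-11234), towards the upper half of `G02ModulusConvergence` (`…Defs.lean`).
Transposition of `SquareTiling.abs_dualPot_sub_le_local` (§D6 of `SquareTilingConjugate.lean`) to
`Ω_δ = discreteDomainGraph Ω δ`: if every exit of the face component inside `sqBox q̂ (2J)` has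
virtual value `c` and some walk of squares outside the component joins `sqBox q̂ (J-1)` to the
outside of `sqBox q̂ (2J)`, then `|facePot - c| ≤ 1 + 8 √E` on the component inside `sqBox q̂ J`
(`abs_facePot_sub_le_local`).
-/

noncomputable section

namespace Summit.CriticalPhenomena.CardyFormulaZ2.Theorems

namespace KirchhoffSlope

open Set Metric Filter Topology SimpleGraph
open Literature.Probability Literature.Probability.LatticeModels Literature.Probability.Percolation
open Literature.Probability.LatticeModels.SquareTiling (stepFlux walkFlux stepFlux_antisymm rectRing rectRing_add_period
  rectRing_mod rectRing_adj exists_rectRing_eq rectRing_mem sum_range_shift_of_periodic sum_rectRing_eq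
  exists_mem_support_on_rectBoundary sum_range_shift_le le_of_meanValue_rect abs_le_of_meanValue_rect
  rectRing_bottom rectRing_right rectRing_top rectRing_left vec2_eq_iff)
open Literature.Probability.RandomPlanarGeometry

variable {Ω : Set ℂ} {δ : ℝ}

open WeakBeurling

open Classical in
/-- **Local bound for the conjugate** ([GP19] use `0 ≤ h' ≤ I*_n` from the planar dual; here a
local substitute needing no global structure). Let `h ∈ [0,1]` be harmonic for `Ω_n` off
`T ∪ B ⊆ ∂Ω_n` with energy `≤ E`, `h'` its conjugate based at `p₀`, and `q̂` a square, `J ≥ 1`,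
such that (i) every exit of the component inside `sqBox q̂ (2J)` has virtual value `c`, and
(ii) some lattice walk of squares outside the component joins `sqBox q̂ (J-1)` to the outside of
`sqBox q̂ (2J)`. Then `|h' - c| ≤ 1 + 8 √E` on the component inside `sqBox q̂ J`. Proof: choose by
length–area a rectangle between the two boxes whose boundary ring has `Σ |dh'| ≤ 8 √E`; the ring
meets the cutting walk, so along the ring every square of the component is joined within the
component to an exit (`|h' - c| ≤ 1 + 8√E` there); conclude by the maximum principle.
[cite: GeorgakopoulosPanagiotis2019, §3.2 (local form)] -/
theorem abs_facePot_sub_le_local (R : ConformalRectangle) (hδ : 0 < δ) {h : Site 2 → ℝ} {T B : Set (Site 2)}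
    (hT : T ⊆ meshBoundary R.carrier δ) (hB : B ⊆ meshBoundary R.carrier δ)
    (hharm : ∀ x, x ∉ T → x ∉ B →
      ∑ y ∈ ((zdGraph 2).neighborFinset x).filter (fun y => (discreteDomainGraph R.carrier δ).Adj x y), (h y - h x) = 0)
    (h01 : ∀ x, h x ∈ Icc (0 : ℝ) 1) {p₀ : Site 2} (hp₀ : IsInnerFace R.carrier δ p₀) {E : ℝ}
    (hE : ∑ e ∈ (edgeSet_discreteDomainGraph_finite R.isBounded hδ).toFinset, sqIncr h e ≤ E)
    {c : ℝ} {qc : Site 2} {J : ℕ} (hJ : 1 ≤ J)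
    (hexit : ∀ p, (faceGraph R.carrier δ).Reachable p₀ p → p ∈ sqBox qc (2 * J) → ∀ n, (zdGraph 2).Adj p n →
      ¬ (faceGraph R.carrier δ).Reachable p₀ n → faceExitVal R.carrier δ h p₀ p n = c)
    {pc pfar : Site 2} (Wcut : (zdGraph 2).Walk pc pfar) (hpc : pc ∈ sqBox qc (J - 1)) (hpfar : pfar ∉ sqBox qc (2 * J))
    (hWcut : ∀ z ∈ Wcut.support, ¬ (faceGraph R.carrier δ).Reachable p₀ z)
    {p : Site 2} (hp : (faceGraph R.carrier δ).Reachable p₀ p) (hpJ : p ∈ sqBox qc J) :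
    |facePot R.carrier δ h p₀ p - c| ≤ 1 + 8 * Real.sqrt E := by
  have hEF := edgeSet_discreteDomainGraph_finite (Ω := R.carrier) R.isBounded hδ
  have hJ' : (1 : ℤ) ≤ J := by exact_mod_cast hJ
  -- good lines
  obtain ⟨t₁, ht₁, hrow₁⟩ := exists_good_row' hEF h hE (qc 0 - 2 * J) (qc 1 + J) hJ
  obtain ⟨t₂, ht₂, hrow₂⟩ := exists_good_row' hEF h hE (qc 0 - 2 * J) (qc 1 - 2 * J) hJ
  obtain ⟨t₃, ht₃, hcol₃⟩ := exists_good_col' hEF h hE (qc 0 + J) (qc 1 - 2 * J) hJ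
  obtain ⟨t₄, ht₄, hcol₄⟩ := exists_good_col' hEF h hE (qc 0 - 2 * J) (qc 1 - 2 * J) hJ
  set yt : ℤ := qc 1 + J + t₁ with hyt
  set yb : ℤ := qc 1 - 2 * J + t₂ with hyb
  set xr : ℤ := qc 0 + J + t₃ with hxr
  set xl : ℤ := qc 0 - 2 * J + t₄ with hxl
  have ht₁' : (t₁ : ℤ) ≤ J := by exact_mod_cast ht₁
  have ht₂' : (t₂ : ℤ) ≤ J := by exact_mod_cast ht₂
  have ht₃' : (t₃ : ℤ) ≤ J := by exact_mod_cast ht₃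
  have ht₄' : (t₄ : ℤ) ≤ J := by exact_mod_cast ht₄
  have hx : xl < xr := by omega
  have hy : yb < yt := by omega
  -- the rectangle lies in `sqBox qc (2J)` and contains `sqBox qc J`
  have hrect_box : ∀ z : Site 2, xl ≤ z 0 → z 0 ≤ xr → yb ≤ z 1 → z 1 ≤ yt → z ∈ sqBox qc (2 * J) := by
    intro z a1 a2 a3 a4
    rw [mem_sqBox, abs_le, abs_le]; omega
  -- the ring sum is at most `8 √E`
  have hsymm : ∀ x y : Site 2, |stepFlux (ecurH R.carrier δ h) (ecurV R.carrier δ h) y x| = |stepFlux (ecurH R.carrier δ h) (ecurV R.carrier δ h) x y| := by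
    intro x y
    by_cases hxy : (zdGraph 2).Adj x y
    · rw [stepFlux_antisymm _ _ (stepKind_of_adj hxy), abs_neg]
    · have h1 : stepFlux (ecurH R.carrier δ h) (ecurV R.carrier δ h) x y = 0 := by
        unfold stepFlux
        have := fun hk : StepKind x y => hxy (adj_of_stepKind hk)
        split_ifs with a1 a2 a3 a4
        · exact (this (.up a1.1 a1.2)).elim
        · exact (this (.down a2.1 a2.2)).elim
        · exact (this (.right a3.1 a3.2)).elim
        · exact (this (.left a4.1 a4.2)).elim
        · rfl
      have h2 : stepFlux (ecurH R.carrier δ h) (ecurV R.carrier δ h) y x = 0 := by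
        unfold stepFlux
        have := fun hk : StepKind y x => hxy (adj_of_stepKind hk).symm
        split_ifs with a1 a2 a3 a4
        · exact (this (.up a1.1 a1.2)).elim
        · exact (this (.down a2.1 a2.2)).elim
        · exact (this (.right a3.1 a3.2)).elim
        · exact (this (.left a4.1 a4.2)).elim
        · rfl
      rw [h1, h2]
  have hring_sum : ∑ k ∈ Finset.range (2 * (xr - xl).toNat + 2 * (yt - yb).toNat),
      |stepFlux (ecurH R.carrier δ h) (ecurV R.carrier δ h) (rectRing xl xr yb yt k) (rectRing xl xr yb yt (k + 1))| ≤ 8 * Real.sqrt E := by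
    rw [sum_rectRing_eq hx hy (w := fun x y => |stepFlux (ecurH R.carrier δ h) (ecurV R.carrier δ h) x y|) hsymm]
    have ha : (xr - xl).toNat + t₄ ≤ 4 * J := by omega
    have hb : (yt - yb).toNat + t₂ ≤ 4 * J := by omega
    -- bottom row `yb = (qc 1 - 2J) + t₂`, abscissae `xl + i = (qc 0 - 2J) + (i + t₄)`
    have e1 : ∑ i ∈ Finset.range (xr - xl).toNat, |stepFlux (ecurH R.carrier δ h) (ecurV R.carrier δ h) ![xl + i, yb] ![xl + i + 1, yb]| ≤ 2 * Real.sqrt E := by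
      refine le_trans (le_of_eq ?_) ((sum_range_shift_le (fun i => abs_nonneg _) ha).trans hrow₂)
      refine Finset.sum_congr rfl fun i _ => ?_
      congr 2 <;> ext j <;> fin_cases j <;> simp [hxl, hyb] <;> ring
    have e3 : ∑ i ∈ Finset.range (xr - xl).toNat, |stepFlux (ecurH R.carrier δ h) (ecurV R.carrier δ h) ![xl + i, yt] ![xl + i + 1, yt]| ≤ 2 * Real.sqrt E := by
      refine le_trans (le_of_eq ?_) ((sum_range_shift_le (fun i => abs_nonneg _) ha).trans hrow₁)
      refine Finset.sum_congr rfl fun i _ => ?_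
      congr 2 <;> ext j <;> fin_cases j <;> simp [hxl, hyt] <;> ring
    -- right column `xr = (qc 0 + J) + t₃`, ordinates `yb + i = (qc 1 - 2J) + (i + t₂)`
    have e2 : ∑ i ∈ Finset.range (yt - yb).toNat, |stepFlux (ecurH R.carrier δ h) (ecurV R.carrier δ h) ![xr, yb + i] ![xr, yb + i + 1]| ≤ 2 * Real.sqrt E := by
      refine le_trans (le_of_eq ?_) ((sum_range_shift_le (fun i => abs_nonneg _) hb).trans hcol₃)
      refine Finset.sum_congr rfl fun i _ => ?_
      congr 2 <;> ext j <;> fin_cases j <;> simp [hxr, hyb] <;> ring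
    have e4 : ∑ i ∈ Finset.range (yt - yb).toNat, |stepFlux (ecurH R.carrier δ h) (ecurV R.carrier δ h) ![xl, yb + i] ![xl, yb + i + 1]| ≤ 2 * Real.sqrt E := by
      refine le_trans (le_of_eq ?_) ((sum_range_shift_le (fun i => abs_nonneg _) hb).trans hcol₄)
      refine Finset.sum_congr rfl fun i _ => ?_
      congr 2 <;> ext j <;> fin_cases j <;> simp [hxl, hyb] <;> ring
    linarith
  -- a square of the ring outside the component
  have hout : ∃ k₁, ¬ (faceGraph R.carrier δ).Reachable p₀ (rectRing xl xr yb yt k₁) := by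
    have hpc' : xl ≤ pc 0 ∧ pc 0 ≤ xr ∧ yb ≤ pc 1 ∧ pc 1 ≤ yt := by
      rw [mem_sqBox, abs_le, abs_le] at hpc; omega
    have hpfar' : ¬ (xl ≤ pfar 0 ∧ pfar 0 ≤ xr ∧ yb ≤ pfar 1 ∧ pfar 1 ≤ yt) := fun hh =>
      hpfar (hrect_box pfar hh.1 hh.2.1 hh.2.2.1 hh.2.2.2)
    obtain ⟨z, hz, a1, a2, a3, a4, hb⟩ := exists_mem_support_on_rectBoundary Wcut hpc' hpfar'
    obtain ⟨k₁, -, hk₁⟩ := exists_rectRing_eq hx hy a1 a2 a3 a4 hb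
    exact ⟨k₁, by rw [hk₁]; exact hWcut z hz⟩
  obtain ⟨k₁, hk₁⟩ := hout
  -- bound on the ring
  have hring : ∀ q, (faceGraph R.carrier δ).Reachable p₀ q → xl ≤ q 0 → q 0 ≤ xr → yb ≤ q 1 → q 1 ≤ yt →
      (q 0 = xl ∨ q 0 = xr ∨ q 1 = yb ∨ q 1 = yt) → |facePot R.carrier δ h p₀ q - c| ≤ 1 + 8 * Real.sqrt E := by
    intro q hq a1 a2 a3 a4 hb
    obtain ⟨k₀, -, rfl⟩ := exists_rectRing_eq hx hy a1 a2 a3 a4 hb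
    refine (abs_facePot_sub_le_of_ring R hδ hT hB hharm h01 hp₀ hx hy (fun k hk hk' => ?_) hk₁ hq).trans
      (by linarith [hring_sum])
    obtain ⟨b1, b2, b3, b4, -⟩ := rectRing_mem hx hy k
    exact hexit _ hk (hrect_box _ b1 b2 b3 b4) _ (rectRing_adj hx hy k) hk'
  -- the maximum principle
  have hFfin : {q : Site 2 | (faceGraph R.carrier δ).Reachable p₀ q}.Finite := by
    obtain ⟨r₀, hr₀⟩ := (isBounded_iff_subset_closedBall (0 : ℂ)).1 R.isBounded
    refine (sqBox_finite 0 ⌈r₀ / δ⌉).subset fun q hq => ?_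
    obtain ⟨W⟩ := hq
    exact mem_sqBox_of_isInnerFace hr₀ hδ (isInnerFace_of_mem_support' hp₀ W (Walk.end_mem_support _))
  have hpbox : xl ≤ p 0 ∧ p 0 ≤ xr ∧ yb ≤ p 1 ∧ p 1 ≤ yt := by
    rw [mem_sqBox, abs_le, abs_le] at hpJ; omega
  refine abs_le_of_meanValue_rect hFfin (g := fun q => facePot R.carrier δ h p₀ q - c)
    (V := fun q n => if (faceGraph R.carrier δ).Reachable p₀ n then facePot R.carrier δ h p₀ n - c
      else faceExitVal R.carrier δ h p₀ q n - c)
    (M := 1 + 8 * Real.sqrt E) (xl := xl) (xr := xr) (yb := yb) (yt := yt) ?_ ?_ ?_ ?_ p hp hpbox.1 hpbox.2.1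
    hpbox.2.2.1 hpbox.2.2.2
  · -- mean value: the four CR-increments around an inner square sum to zero
    intro q hq a1 a2 a3 a4
    have hqI : IsInnerFace R.carrier δ q := by
      obtain ⟨W⟩ := hq; exact isInnerFace_of_mem_support' hp₀ W (Walk.end_mem_support _)
    have hterm : ∀ k : Fin 4, ((if (faceGraph R.carrier δ).Reachable p₀ (q + cornerUnit k)
        then facePot R.carrier δ h p₀ (q + cornerUnit k) - c else faceExitVal R.carrier δ h p₀ q (q + cornerUnit k) - c) -
        (facePot R.carrier δ h p₀ q - c)) = stepFlux (ecurH R.carrier δ h) (ecurV R.carrier δ h) q (q + cornerUnit k) := by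
      intro k
      split_ifs with hr
      · have hadj : (faceGraph R.carrier δ).Adj q (q + cornerUnit k) := by
          refine faceGraph_adj_iff.2 ⟨adj_of_stepKind (stepKind_add_cornerUnit q k), hqI, ?_⟩
          obtain ⟨W⟩ := hr; exact isInnerFace_of_mem_support' hp₀ W (Walk.end_mem_support _)
        rw [← facePot_sub_facePot_of_adj R hδ hT hB hharm hp₀ hq hadj]
        ring
      · rw [faceExitVal]; ring
    rw [Finset.sum_congr rfl fun k _ => hterm k, Fin.sum_univ_four]
    have := sum_stepFlux_eq_zero_of_isInnerFace (h := h) hqI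
    simp only [cornerUnit] at this ⊢
    rw [show q + -Pi.single (0 : Fin 2) (1 : ℤ) = q - Pi.single 0 1 by abel,
      show q + -Pi.single (1 : Fin 2) (1 : ℤ) = q - Pi.single 1 1 by abel]
    linarith
  · intro q _ k hk
    simp only [Set.mem_setOf_eq] at hk
    rw [if_pos hk]
  · intro q hq a1 a2 a3 a4 k hk
    simp only [Set.mem_setOf_eq] at hk hq
    rw [if_neg hk, hexit q hq (hrect_box q a1.le a2.le a3.le a4.le) _ (adj_of_stepKind (stepKind_add_cornerUnit q k)) hk,
      sub_self, abs_zero]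
    positivity
  · intro q hq a1 a2 a3 a4 hb
    exact hring q hq a1 a2 a3 a4 hb


/-! ### §D7. The weak Beurling estimate for the conjugate near the exits -/

end KirchhoffSlope

end Summit.CriticalPhenomena.CardyFormulaZ2.Theorems
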